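import Summits.Ventures.Crystal3D.Theorems.StickyWulffConstantStackingLiminfVacancy
import Summits.Ventures.Crystal3D.Theorems.StickyWulffConstantStackingLiminfGridPairCount
import Summits.Ventures.Crystal3D.Theorems.StickyWulffConstantStackingLiminfGridBoundary
import Summits.Ventures.Crystal3D.Theorems.StickyWulffConstantStackingLiminfIndexBox
import HarnessLib

/-!
# The BAD-MASS bound of line `LayerChain` v4 (crux `StackingLiminf`, stmt-Ventures-19145): the mass
# of the doubly mollified density below the plateau is `O(K L³ · D / (θ L² K)) = O(L·D/θ)`

Route `StickyWulffConstant` of the venture `Summits/Ventures/Crystal3D` (cell `crystal3d-full`).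
**`badMass_le`**: for a Hägg word `σ`, an injective configuration `x ⊂ barlowStacking 1 √(2/3) σ`,
scales `1 ≤ K ≤ L` and `θ > 0` with `96√2·bumpConst/K ≤ θ/2`,
`∫_{w ≤ 1−θ} w ≤ (1/√2) · #B · R · (12N − 2·numContacts x) / m₀`,
`w = smooth x K L`, `#B·R = (2⌈3K⌉+1)(2⌈9L⌉+1)(2⌈6L⌉+1)(⌈3K⌉+⌈9L⌉+⌈6L⌉)` (index box and its `ℓ¹`
radius), `m₀ = (θ/2)·πL²K/(16·bumpConst)`.
Proof (eng g6 architecture, no product integrals): `w = Σ_i κ_i` (one-site kernels, `∫κ_i = 1/√2`);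
ball `i` is BAD if its kernel meets `{w ≤ 1−θ}`; only bad balls contribute, each at most `1/√2`;
a bad ball has, by the vacancy bound (`card_vacant_near_ge`), at least `m₀` vacant lattice indices in
the index box `idx i + B` (`idx_sub_le_of_near`), and `(i, t) ↦ (idx i, t − idx i)` injects these into
the occupied–vacant pairs of the window `B`, which number at most `#B·R·M`
(`card_pairs_le`) with `M ≤ 12N − 2·numContacts` (`card_grid_boundary_add_le`).
WHAT THIS IS NOT: not stub (C) (the assembly with R6/R7 and the choice of `θ, λ, K₀` follows);
rung F-C1 not moved.
-/

noncomputable section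

namespace Summit.Ventures.Crystal3D.Theorems.PlateauHeight

open MeasureTheory Metric
open Literature.MathematicalPhysics.StatisticalMechanics (IsHaggSeq barlowPos barlowStacking)
open Summit.Ventures.Crystal3D.Cruxes.StackingLiminf.LayerChainV4 (bump bumpConst dens eta smooth)
open Summit.Ventures.Crystal3D.LayerChain (dot3)

/-- An integer whose real cast has absolute value `≤ c` lies in `Icc (−⌈c⌉₊) ⌈c⌉₊`. -/
theorem mem_Icc_of_abs_le {z : ℤ} {c : ℝ} (h : |(z : ℝ)| ≤ c) :
    z ∈ Finset.Icc (-(⌈c⌉₊ : ℤ)) (⌈c⌉₊ : ℤ) := by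
  rw [Finset.mem_Icc]
  have h1 : ((|z| : ℤ) : ℝ) ≤ (⌈c⌉₊ : ℝ) := by
    rw [Int.cast_abs]
    exact h.trans (Nat.le_ceil c)
  have h2 : |z| ≤ (⌈c⌉₊ : ℤ) := by exact_mod_cast h1
  constructor <;> linarith [abs_le.1 h2 |>.1, abs_le.1 h2 |>.2]

/-- **Bad-mass bound.** -/
theorem badMass_le {σ : ℤ → ℤ} (hσ : IsHaggSeq σ) {N : ℕ} (x : Fin N → EuclideanSpace ℝ (Fin 3))
    (hx : Function.Injective x) (hmem : ∀ i, x i ∈ barlowStacking 1 (Real.sqrt (2 / 3)) σ)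
    {K L θ : ℝ} (hK : 1 ≤ K) (hKL : K ≤ L) (hθ : 0 < θ)
    (hθK : 96 * Real.sqrt 2 * bumpConst / K ≤ θ / 2) :
    ∫ y in {y | smooth x K L y ≤ 1 - θ}, smooth x K L y ≤
      1 / Real.sqrt 2 *
        (((2 * ⌈3 * K⌉₊ + 1) * (2 * ⌈9 * L⌉₊ + 1) * (2 * ⌈6 * L⌉₊ + 1) *
            (⌈3 * K⌉₊ + ⌈9 * L⌉₊ + ⌈6 * L⌉₊) * (12 * N - 2 * Summit.Ventures.Crystal3D.numContacts x) :
            ℕ) : ℝ) /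
        (θ / 2 * (Real.pi * L ^ 2 * K / (16 * bumpConst))) := by
  classical
  have hK0 : 0 < K := by linarith
  have hL0 : 0 < L := by linarith
  have hr2 : 0 < Real.sqrt 2 := Real.sqrt_pos.2 (by norm_num)
  have hb : 0 < bumpConst := bumpConst_pos
  set m₀ : ℝ := θ / 2 * (Real.pi * L ^ 2 * K / (16 * bumpConst)) with hm₀
  have hm₀pos : 0 < m₀ := by positivity
  -- indices of the balls
  have hmem' := hmem
  choose kk aa bb hkab using hmem'
  set idx : Fin N → ℤ × ℤ × ℤ := fun i => (kk i, aa i, bb i) with hidx_def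
  have hidx : ∀ i, x i = barlowPos 1 (Real.sqrt (2 / 3)) σ (idx i).1 (idx i).2.1 (idx i).2.2 :=
    fun i => hkab i
  have hinj : Function.Injective idx := by
    intro i j hij
    apply hx
    rw [hidx i, hidx j, hij]
  set X : Finset (ℤ × ℤ × ℤ) := Finset.univ.image idx with hX
  -- the index box
  set n₃ : ℕ := ⌈3 * K⌉₊ with hn₃
  set n₁ : ℕ := ⌈9 * L⌉₊ with hn₁
  set n₂ : ℕ := ⌈6 * L⌉₊ with hn₂
  set B : Finset (ℤ × ℤ × ℤ) := Finset.Icc (-(n₃ : ℤ)) n₃ ×ˢ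
    (Finset.Icc (-(n₁ : ℤ)) n₁ ×ˢ Finset.Icc (-(n₂ : ℤ)) n₂) with hB
  have hBcard : B.card = (2 * n₃ + 1) * (2 * n₁ + 1) * (2 * n₂ + 1) := by
    rw [hB, Finset.card_product, Finset.card_product, Int.card_Icc, Int.card_Icc, Int.card_Icc]
    have e : ∀ n : ℕ, ((n : ℤ) + 1 - -(n : ℤ)).toNat = 2 * n + 1 := fun n => by omega
    rw [e, e, e]; ring
  have hBR : ∀ Δ ∈ B, (|Δ.1| + |Δ.2.1| + |Δ.2.2|).toNat ≤ n₃ + n₁ + n₂ := by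
    intro Δ hΔ
    rw [hB, Finset.mem_product, Finset.mem_product, Finset.mem_Icc, Finset.mem_Icc,
      Finset.mem_Icc] at hΔ
    have h1 : |Δ.1| ≤ n₃ := abs_le.2 ⟨hΔ.1.1, hΔ.1.2⟩
    have h2 : |Δ.2.1| ≤ n₁ := abs_le.2 ⟨hΔ.2.1.1, hΔ.2.1.2⟩
    have h3 : |Δ.2.2| ≤ n₂ := abs_le.2 ⟨hΔ.2.2.1, hΔ.2.2.2⟩
    omega
  -- the boundary bound and the pair count
  set M : ℕ := 12 * N - 2 * Summit.Ventures.Crystal3D.numContacts x with hM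
  have hMb : ∀ u : ℤ × ℤ × ℤ, |u.1| + |u.2.1| + |u.2.2| = 1 →
      (X.filter fun a => a + u ∉ X).card ≤ M := by
    intro u hu
    have := card_grid_boundary_add_le hσ x hx hmem idx hidx u hu
    rw [← hX] at this
    omega
  have hpairs := card_pairs_le X B (n₃ + n₁ + n₂) M hBR hMb
  -- kernels and the sub-plateau set
  set κ : Fin N → (Fin 3 → ℝ) → ℝ := fun i => smooth (fun _ : Fin 1 => x i) K L with hκ
  have hκint : ∀ i, Integrable (κ i) := fun i =>
    (contDiff_smooth (fun _ : Fin 1 => x i) L hK0).continuous.integrable_of_hasCompactSupport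
      (hasCompactSupport_smooth _ hK0 hL0)
  have hκ0 : ∀ i y, 0 ≤ κ i y := fun i y => smooth_nonneg _ hK0 L y
  set S : Set (Fin 3 → ℝ) := {y | smooth x K L y ≤ 1 - θ} with hS
  have hSm : MeasurableSet S :=
    measurableSet_le (contDiff_smooth x L hK0).continuous.measurable measurable_const
  -- bad balls
  set bad : Finset (Fin N) := Finset.univ.filter (fun i => ∃ y, smooth x K L y ≤ 1 - θ ∧ κ i y ≠ 0)
    with hbad
  -- (1) only bad balls contribute, each at most `1/√2`
  have h1 : ∫ y in S, smooth x K L y ≤ 1 / Real.sqrt 2 * bad.card := by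
    have hsplit : ∫ y in S, smooth x K L y = ∑ i, ∫ y in S, κ i y := by
      rw [← integral_finsetSum _ fun i _ => (hκint i).integrableOn]
      refine setIntegral_congr_fun hSm fun y _ => ?_
      exact smooth_eq_sum_single x hL0 y
    rw [hsplit]
    have hterm : ∀ i, ∫ y in S, κ i y ≤ if i ∈ bad then 1 / Real.sqrt 2 else 0 := by
      intro i
      by_cases hi : i ∈ bad
      · rw [if_pos hi]
        calc ∫ y in S, κ i y ≤ ∫ y, κ i y := setIntegral_le_integral (hκint i) (ae_of_all _ (hκ0 i))
          _ = 1 / Real.sqrt 2 := integral_smooth_single (x i) hK0 hL0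
      · rw [if_neg hi]
        refine le_of_eq (setIntegral_eq_zero_of_forall_eq_zero fun y hy => ?_)
        by_contra hne
        apply hi
        rw [hbad, Finset.mem_filter]
        exact ⟨Finset.mem_univ _, y, hy, hne⟩
    calc ∑ i, ∫ y in S, κ i y ≤ ∑ i, (if i ∈ bad then 1 / Real.sqrt 2 else 0) :=
        Finset.sum_le_sum fun i _ => hterm i
      _ = 1 / Real.sqrt 2 * bad.card := by
        rw [Finset.sum_ite_mem, Finset.univ_inter, Finset.sum_const, nsmul_eq_mul, mul_comm]
  -- (2) every bad ball carries `m₀` vacant indices in its index box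
  have h2 : (bad.card : ℝ) * m₀ ≤
      (((X ×ˢ B).filter fun q => q.1 + q.2 ∉ X).card : ℝ) := by
    -- witnesses
    have hwit : ∀ i ∈ bad, ∃ y, smooth x K L y ≤ 1 - θ ∧ κ i y ≠ 0 := fun i hi => by
      rw [hbad, Finset.mem_filter] at hi; exact hi.2
    choose! ysel hysel using hwit
    -- the vacant sets
    set T : Fin N → Finset (ℤ × ℤ × ℤ) := fun i =>
      ((X ∪ B.image fun Δ => Δ + idx i).filter fun t => t ∉ X).filter fun t =>
        |ysel i 2 - (barlowPos 1 (Real.sqrt (2 / 3)) σ t.1 t.2.1 t.2.2) 2| < K ∧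
        |ysel i 0 - (barlowPos 1 (Real.sqrt (2 / 3)) σ t.1 t.2.1 t.2.2) 0| < K + L ∧
        |ysel i 1 - (barlowPos 1 (Real.sqrt (2 / 3)) σ t.1 t.2.1 t.2.2) 1| < K + L with hT
    -- each bad ball: `m₀ ≤ #T i`
    have hTi : ∀ i ∈ bad, m₀ ≤ ((T i).card : ℝ) := by
      intro i hi
      obtain ⟨hwy, hκy⟩ := hysel i hi
      -- the kernel is nonzero at `ysel i`: so `ysel i` is close to `x i`
      have hy2 : |ysel i 2 - x i 2| < K := by
        by_contra h; rw [not_lt] at h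
        exact hκy (smooth_single_eq_zero_of_height (x i) hK0 L h)
      have hy0 : |ysel i 0 - x i 0| < K + L := by
        by_contra h; rw [not_lt] at h
        exact hκy (smooth_single_eq_zero_of_lateral (x i) hK0 hL0 (Or.inl h))
      have hy1 : |ysel i 1 - x i 1| < K + L := by
        by_contra h; rw [not_lt] at h
        exact hκy (smooth_single_eq_zero_of_lateral (x i) hK0 hL0 (Or.inr h))
      refine card_vacant_near_ge σ x idx hinj hidx (X ∪ B.image fun Δ => Δ + idx i)
        Finset.subset_union_left hK hL0 (ysel i) ?_ hθK hwy
      -- every lattice point within `K` of the lateral window of `ysel i` has its index in the box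
      intro ζ hζ1 hζ2 k a b hd
      apply Finset.mem_union_right
      rw [Finset.mem_image]
      refine ⟨(k, a, b) - idx i, ?_, by abel⟩
      -- coordinates of the lattice point relative to `x i`
      set P := barlowPos 1 (Real.sqrt (2 / 3)) σ k a b with hP
      have hc : ∀ l : Fin 3, |ysel i l - (![ζ.1, ζ.2, 0] : Fin 3 → ℝ) l - P l| < K := by
        intro l
        have := abs_apply_le_sqrt_dot3
          ((fun l => ysel i l - (![ζ.1, ζ.2, 0] : Fin 3 → ℝ) l) - WithLp.ofLp P) l
        simp only [Pi.sub_apply] at this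
        exact lt_of_le_of_lt this hd
      have hc2 := hc 2
      have hc0 := hc 0
      have hc1 := hc 1
      simp only [Matrix.cons_val_two, Matrix.tail_cons, Matrix.head_cons, Matrix.cons_val_zero,
        Matrix.cons_val_one, sub_zero] at hc2 hc0 hc1
      have hP2 : |P 2 - x i 2| < 2 * K := by
        have t1 := abs_sub_le (P 2) (ysel i 2) (x i 2)
        have e1 : |P 2 - ysel i 2| = |ysel i 2 - P 2| := abs_sub_comm _ _
        linarith
      have hP0 : |P 0 - x i 0| < 2 * K + 2 * L := by
        have t1 := abs_sub_le (P 0) (ysel i 0 - ζ.1) (x i 0)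
        have t2 := abs_sub_le (ysel i 0 - ζ.1) (ysel i 0) (x i 0)
        have e1 : |P 0 - (ysel i 0 - ζ.1)| = |ysel i 0 - ζ.1 - P 0| := abs_sub_comm _ _
        have t3 : |ysel i 0 - ζ.1 - ysel i 0| = |ζ.1| := by
          rw [show ysel i 0 - ζ.1 - ysel i 0 = -ζ.1 by ring, abs_neg]
        linarith
      have hP1 : |P 1 - x i 1| < 2 * K + 2 * L := by
        have t1 := abs_sub_le (P 1) (ysel i 1 - ζ.2) (x i 1)
        have t2 := abs_sub_le (ysel i 1 - ζ.2) (ysel i 1) (x i 1)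
        have e1 : |P 1 - (ysel i 1 - ζ.2)| = |ysel i 1 - ζ.2 - P 1| := abs_sub_comm _ _
        have t3 : |ysel i 1 - ζ.2 - ysel i 1| = |ζ.2| := by
          rw [show ysel i 1 - ζ.2 - ysel i 1 = -ζ.2 by ring, abs_neg]
        linarith
      rw [hP, hidx i] at hP2 hP0 hP1
      obtain ⟨dk, da, db⟩ := idx_sub_le_of_near hσ hK hKL (idx i).1 (idx i).2.1 (idx i).2.2 k a b
        hP2 hP0 hP1
      have dk' : |((k - (idx i).1 : ℤ) : ℝ)| ≤ 3 * K := by push_cast; exact dk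
      have da' : |((a - (idx i).2.1 : ℤ) : ℝ)| ≤ 9 * L := by push_cast; exact da
      have db' : |((b - (idx i).2.2 : ℤ) : ℝ)| ≤ 6 * L := by push_cast; exact db
      rw [hB, Finset.mem_product, Finset.mem_product]
      exact ⟨mem_Icc_of_abs_le dk', mem_Icc_of_abs_le da', mem_Icc_of_abs_le db'⟩
    -- the injection `(i, t) ↦ (idx i, t − idx i)` into the pairs of the window
    set Φ : Fin N → ℤ × ℤ × ℤ → (ℤ × ℤ × ℤ) × (ℤ × ℤ × ℤ) := fun i t => (idx i, t - idx i) with hΦ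
    have hΦinj : ∀ i, Function.Injective (Φ i) := by
      intro i t t' h
      simp only [hΦ, Prod.mk.injEq] at h
      exact sub_left_injective h.2
    have hsub : bad.biUnion (fun i => (T i).image (Φ i)) ⊆
        (X ×ˢ B).filter fun q => q.1 + q.2 ∉ X := by
      intro q hq
      rw [Finset.mem_biUnion] at hq
      obtain ⟨i, hi, hq⟩ := hq
      rw [Finset.mem_image] at hq
      obtain ⟨t, ht, rfl⟩ := hq
      rw [hT, Finset.mem_filter, Finset.mem_filter, Finset.mem_union] at ht
      obtain ⟨⟨htF, htX⟩, _⟩ := ht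
      rw [Finset.mem_filter, Finset.mem_product]
      refine ⟨⟨Finset.mem_image_of_mem _ (Finset.mem_univ i), ?_⟩, by simpa [hΦ] using htX⟩
      rcases htF with h | h
      · exact absurd h htX
      · rw [Finset.mem_image] at h
        obtain ⟨Δ, hΔ, rfl⟩ := h
        simpa [hΦ] using hΔ
    have hdisj : (bad : Set (Fin N)).PairwiseDisjoint fun i => (T i).image (Φ i) := by
      intro i _ j _ hij
      rw [Function.onFun, Finset.disjoint_left]
      intro q hqi hqj
      rw [Finset.mem_image] at hqi hqj
      obtain ⟨t, _, rfl⟩ := hqi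
      obtain ⟨t', _, h⟩ := hqj
      simp only [hΦ, Prod.mk.injEq] at h
      exact hij (hinj h.1).symm
    have hcard : ∑ i ∈ bad, (T i).card = (bad.biUnion fun i => (T i).image (Φ i)).card := by
      rw [Finset.card_biUnion hdisj]
      exact Finset.sum_congr rfl fun i _ => (Finset.card_image_of_injective _ (hΦinj i)).symm
    have hle := Finset.card_le_card hsub
    rw [← hcard] at hle
    calc (bad.card : ℝ) * m₀ = ∑ i ∈ bad, m₀ := by rw [Finset.sum_const, nsmul_eq_mul]
      _ ≤ ∑ i ∈ bad, ((T i).card : ℝ) := Finset.sum_le_sum hTi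
      _ = ((∑ i ∈ bad, (T i).card : ℕ) : ℝ) := by push_cast; rfl
      _ ≤ _ := by exact_mod_cast hle
  -- (3) assemble
  have h3 : (bad.card : ℝ) ≤ ((B.card * (n₃ + n₁ + n₂) * M : ℕ) : ℝ) / m₀ := by
    rw [le_div_iff₀ hm₀pos]
    exact h2.trans (by exact_mod_cast hpairs)
  rw [hBcard] at h3
  calc ∫ y in S, smooth x K L y ≤ 1 / Real.sqrt 2 * bad.card := h1
    _ ≤ 1 / Real.sqrt 2 * (((2 * n₃ + 1) * (2 * n₁ + 1) * (2 * n₂ + 1) * (n₃ + n₁ + n₂) * M : ℕ) : ℝ) /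
          m₀ := by
      rw [mul_div_assoc]
      exact mul_le_mul_of_nonneg_left h3 (by positivity)

end Summit.Ventures.Crystal3D.Theorems.PlateauHeight

end
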